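import Summits.Ventures.PercRepro.SevenThreeWitnessSum
import Summits.Ventures.PercRepro.PerFlatTransfer

/-!
# PercRepro — the `(7,3)` cell, (R6) part (e): the frame of the small-planes inequality (night-3, gen 4)

The chain-independent pieces of `perPlane_positive_of_core`: for a plane `G` with `ρ(E ∖ G) + t = 7`,
* a witness pool `K ⊆ E ∖ G` with `|K| + t = 7` and `ρ(G ∪ K) = 7` (a basis of `E ∖ G`; `exists_pool`);
* the accounting: the witnesses `B ∪ X`, `B ∈ R₃(G)`, `X ∈ W(K)`, are distinct members of `Yq M 7 3`, so
  `Σ_B Σ_X f(G, B ∪ X)/D(B ∪ X) ≤ Σ_{S ∈ Yq} f(G, S)/D(S)` (`sum_R3_W_le_sum_Yq`);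
* the line weight of a `B` met by no line in `≥ 4` points: `Λ(B) = C(|B|, 2) + 3·λ(B)` with `λ(B)` the number of
  rank-`2` triples inside `B` (`Lam_eq_of_no_four`), i.e. `Cells.Lam |B| (lam3 M B)`.
With p3's `card_UqG_le_naive` (the demand) and the chain's plane types with their `(b, λ)`-profiles, the `27`
cells of `SevenThreeSmallCells.lean` then close `perPlane_positive_of_core` (`SevenThreeSmallPlanes.lean`).
The `b`-subsets through a given `S ⊆ G` number `C(|G| − |S|, b − |S|)` (`card_filter_subset_powersetCard`, `'`).
Axioms: standard.
-/

namespace PercRepro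

namespace SevenThree

open Finset ThmH SixThree PerFlat

variable {α : Type*} [DecidableEq α] {M : Matroid α} [M.Finite]

/-- **The witness pool.**  If `ρ(E ∖ G) + t = 7` and `M` has rank `7`, a basis `K` of `E ∖ G` has `|K| + t = 7` and
`ρ(G ∪ K) = 7`. -/
theorem exists_pool {G : Finset α} (hG : G ∈ planes M) (hrank : M.eRank = 7) {t : ℕ}
    (ht : M.eRk ((gr M \ G : Finset α) : Set α) + (t : ℕ∞) = 7) :
    ∃ K : Finset α, K ⊆ gr M \ G ∧ K.card + t = 7 ∧ M.eRk ((G ∪ K : Finset α) : Set α) = 7 := by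
  classical
  have hGg : G ⊆ gr M := (mem_planes.1 hG).1
  have hsub : ((gr M \ G : Finset α) : Set α) ⊆ M.E := by
    rw [← coe_gr M]; exact_mod_cast (Finset.sdiff_subset : gr M \ G ⊆ gr M)
  obtain ⟨I, hI⟩ := M.exists_isBasis ((gr M \ G : Finset α) : Set α) hsub
  have hIfin : I.Finite := (gr M \ G).finite_toSet.subset hI.subset
  refine ⟨hIfin.toFinset, ?_, ?_, ?_⟩
  · intro y hy
    rw [Set.Finite.mem_toFinset] at hy
    exact_mod_cast hI.subset hy
  · have h := hI.encard_eq_eRk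
    rw [Set.Finite.encard_eq_coe_toFinset_card hIfin] at h
    have : ((hIfin.toFinset.card : ℕ) : ℕ∞) + (t : ℕ∞) = 7 := by rw [h]; exact ht
    exact_mod_cast this
  · have hunion : ((G ∪ hIfin.toFinset : Finset α) : Set α) = I ∪ (G : Set α) := by
      rw [Finset.coe_union, Set.Finite.coe_toFinset, Set.union_comm]
    rw [hunion, hI.eRk_eq_eRk_union]
    have hE : ((gr M \ G : Finset α) : Set α) ∪ (G : Set α) = M.E := by
      rw [← Finset.coe_union, Finset.sdiff_union_of_subset hGg, coe_gr]
    rw [hE, M.eRk_ground, hrank]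

/-- A witness `B ∪ X` (`B ∈ R₃(G)`, `X ∈ W(K)`, `K ⊆ E ∖ G`) is a middle set: `3 < ρ(B ∪ X) < 7`. -/
theorem union_mem_Yq {G B K X : Finset α} (hG : G ∈ planes M) (hK : K ⊆ gr M \ G)
    (hB : B ∈ R3 M G) (hX : X ∈ W K) : B ∪ X ∈ Yq M 7 3 := by
  have hGg : G ⊆ gr M := (mem_planes.1 hG).1
  unfold R3 at hB
  rw [Finset.mem_filter, Finset.mem_powerset] at hB
  have hXK : X ⊆ K ∧ 1 ≤ X.card ∧ X.card ≤ 3 := by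
    unfold W at hX
    rw [Finset.mem_union, Finset.mem_union, Finset.mem_powersetCard, Finset.mem_powersetCard,
      Finset.mem_powersetCard] at hX
    rcases hX with (h | h) | h <;> exact ⟨h.1, by omega, by omega⟩
  have hXg : X ⊆ gr M := hXK.1.trans (hK.trans Finset.sdiff_subset)
  have hXG : Disjoint X G := Finset.disjoint_of_subset_left (hXK.1.trans hK) Finset.sdiff_disjoint
  have hcl : M.closure (B : Set α) = (G : Set α) := closure_eq_of_subset_plane hG hB.1 hB.2
  have hrank : M.eRk ((B ∪ X : Finset α) : Set α) = M.eRk ((G ∪ X : Finset α) : Set α) :=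
    eRk_union_eq_of_closure hcl
  unfold Yq
  rw [Finset.mem_filter, Finset.mem_powerset]
  refine ⟨Finset.union_subset (hB.1.trans hGg) hXg, ?_, ?_⟩
  · rw [hrank]
    have h4 := four_le_eRk_union hG hXg hXG (Finset.card_pos.1 (by omega))
    exact lt_of_lt_of_le (by decide) h4
  · rw [hrank]
    have h := eRk_union_le_eRk_add_card (M := M) G X
    rw [(mem_planes.1 hG).2.2] at h
    have h6 : M.eRk ((G ∪ X : Finset α) : Set α) ≤ 6 :=
      h.trans (by exact_mod_cast (show 3 + X.card ≤ 6 by omega))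
    exact lt_of_le_of_lt h6 (by decide)

/-- **The accounting.**  Summing the witness sums of all `B ∈ R₃(G)` over the pool `K` undercounts the supply
of `G` from `Yq M 7 3`: the map `(B, X) ↦ B ∪ X` is injective (`B = S ∩ G`, `X = S ∖ G`). -/
theorem sum_R3_W_le_sum_Yq {G K : Finset α} (hG : G ∈ planes M) (hK : K ⊆ gr M \ G) :
    ∑ B ∈ R3 M G, ∑ X ∈ W K, fRule M G (B ∪ X) / D M (B ∪ X) ≤ ∑ S ∈ Yq M 7 3, fRule M G S / D M S := by
  classical
  rw [Finset.sum_product' (s := R3 M G) (t := W K) (f := fun B X => fRule M G (B ∪ X) / D M (B ∪ X)) |>.symm]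
  have hinj : Set.InjOn (fun P : Finset α × Finset α => P.1 ∪ P.2) ((R3 M G ×ˢ W K : Finset _) : Set _) := by
    intro P hP P' hP' h
    simp only at h
    rw [Finset.mem_coe, Finset.mem_product] at hP hP'
    have hB : ∀ Q : Finset α × Finset α, Q ∈ R3 M G ×ˢ W K → (Q.1 ∪ Q.2) ∩ G = Q.1 ∧ (Q.1 ∪ Q.2) \ G = Q.2 := by
      intro Q hQ
      rw [Finset.mem_product] at hQ
      have hQ1 : Q.1 ⊆ G := by
        have := hQ.1; unfold R3 at this; rw [Finset.mem_filter, Finset.mem_powerset] at this; exact this.1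
      have hQ2 : Q.2 ⊆ K := by
        have := hQ.2; unfold W at this
        rw [Finset.mem_union, Finset.mem_union, Finset.mem_powersetCard, Finset.mem_powersetCard,
          Finset.mem_powersetCard] at this
        rcases this with (h | h) | h <;> exact h.1
      have hdisj : Disjoint Q.2 G := Finset.disjoint_of_subset_left (hQ2.trans hK) Finset.sdiff_disjoint
      refine ⟨union_inter_eq_of_disjoint hQ1 hdisj, ?_⟩
      ext y
      rw [Finset.mem_sdiff, Finset.mem_union]
      constructor
      · rintro ⟨hy | hy, hyG⟩
        · exact absurd (hQ1 hy) hyG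
        · exact hy
      · intro hy
        exact ⟨Or.inr hy, Finset.disjoint_left.1 hdisj hy⟩
    obtain ⟨h1, h2⟩ := hB P (Finset.mem_product.2 hP)
    obtain ⟨h1', h2'⟩ := hB P' (Finset.mem_product.2 hP')
    rw [h] at h1 h2
    exact Prod.ext (h1.symm.trans h1') (h2.symm.trans h2')
  rw [← Finset.sum_image (f := fun S => fRule M G S / D M S) hinj]
  apply Finset.sum_le_sum_of_subset_of_nonneg
  · intro S hS
    rw [Finset.mem_image] at hS
    obtain ⟨P, hP, rfl⟩ := hS
    rw [Finset.mem_product] at hP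
    exact union_mem_Yq hG hK hP.1 hP.2
  · intro S _ _
    exact div_nonneg (fRule_nonneg M G S) (D_nonneg M S)

/-- `λ(B)`: the number of rank-`2` triples inside `B` (the three-point lines of `M|B` when no line has `4` points). -/
noncomputable def lam3 (M : Matroid α) [M.Finite] (B : Finset α) : ℕ :=
  ((B.powersetCard 3).filter (fun T : Finset α => M.eRk (T : Set α) = 2)).card

/-- **The line weight of a short-lined `B`**: if every line meets `B` in `≤ 3` points,
`Λ(B) = C(|B|, 2) + 3·λ(B)` — the two-point traces weigh `1`, the three-point traces `6 = 1 + 3·C(3,2) − 3`, and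
`Σ_L C(|L ∩ B|, 2) = C(|B|, 2)` (p2's `sum_choose_linesOf`). -/
theorem Lam_eq_of_no_four (hs : Simple M) {B : Finset α} (hB : B ⊆ gr M)
    (hno4 : ∀ L ∈ linesOf M B, (L ∩ B).card ≤ 3) :
    Lam M B = Cells.Lam B.card (lam3 M B) := by
  classical
  -- the traces of the lines of `M|B`: `2` or `3` points
  have htr : ∀ L ∈ linesOf M B, (L ∩ B).card = 2 ∨ (L ∩ B).card = 3 := by
    intro L hL
    have h2 : 2 ≤ (L ∩ B).card := (Finset.mem_filter.1 hL).2
    have h3 := hno4 L hL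
    omega
  set L₃ := (linesOf M B).filter (fun L => (L ∩ B).card = 3) with hL₃
  -- `Λ = #linesOf + 5 · #L₃`
  have hLam : Lam M B = ((linesOf M B).card : ℚ) + 5 * (L₃.card : ℚ) := by
    unfold Lam
    have : ∀ L ∈ linesOf M B, (6 : ℚ) ^ ((L ∩ B).card - 2) = 1 + 5 * (if (L ∩ B).card = 3 then (1 : ℚ) else 0) := by
      intro L hL
      rcases htr L hL with h | h
      · rw [h, if_neg (by omega)]; norm_num
      · rw [h, if_pos rfl]; norm_num
    rw [Finset.sum_congr rfl this, Finset.sum_add_distrib, Finset.sum_const, nsmul_eq_mul, mul_one,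
      ← Finset.mul_sum, Finset.sum_boole]
  -- `C(|B|, 2) = #linesOf + 2 · #L₃` (each two-point trace contributes `1`, each three-point trace `3`)
  have hchoose : B.card.choose 2 = (linesOf M B).card + 2 * L₃.card := by
    rw [← sum_choose_linesOf hs hB]
    have : ∀ L ∈ linesOf M B, ((L ∩ B).card).choose 2 = 1 + 2 * (if (L ∩ B).card = 3 then 1 else 0) := by
      intro L hL
      rcases htr L hL with h | h
      · rw [h, if_neg (by omega)]; decide
      · rw [h, if_pos rfl]; decide
    rw [Finset.sum_congr rfl this, Finset.sum_add_distrib, Finset.sum_const, smul_eq_mul, mul_one,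
      ← Finset.mul_sum, Finset.sum_boole]
    simp only [Nat.cast_id]
    rfl
  -- `#L₃ = λ(B)`: `L ↦ L ∩ B` is a bijection onto the rank-`2` triples of `B`
  have hbij : L₃.card = lam3 M B := by
    unfold lam3
    apply Finset.card_bij (fun L _ => L ∩ B)
    · intro L hL
      rw [hL₃, Finset.mem_filter] at hL
      rw [Finset.mem_filter, Finset.mem_powersetCard]
      refine ⟨⟨Finset.inter_subset_right, hL.2⟩, ?_⟩
      exact eRk_eq_two_of_subset_line hs (Finset.mem_filter.1 hL.1).1 Finset.inter_subset_left
        (by rw [hL.2]; norm_num)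
    · intro L hL L' hL' h
      rw [hL₃, Finset.mem_filter] at hL hL'
      have hL1 : L ∈ lines M := (Finset.mem_filter.1 hL.1).1
      have hL1' : L' ∈ lines M := (Finset.mem_filter.1 hL'.1).1
      obtain ⟨a, b, hab, hpair⟩ : ∃ a b, a ≠ b ∧ a ∈ L ∩ B ∧ b ∈ L ∩ B := by
        have : 1 < (L ∩ B).card := by rw [hL.2]; norm_num
        obtain ⟨a, ha, b, hb, hab⟩ := Finset.one_lt_card.1 this
        exact ⟨a, b, hab, ha, hb⟩
      have haL' : a ∈ L' ∩ B := by rw [← h]; exact hpair.1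
      have hbL' : b ∈ L' ∩ B := by rw [← h]; exact hpair.2
      exact lines_eq_of_two_mem hs hL1 hL1' (Finset.mem_inter.1 hpair.1).1 (Finset.mem_inter.1 hpair.2).1
        (Finset.mem_inter.1 haL').1 (Finset.mem_inter.1 hbL').1 hab
    · intro T hT
      rw [Finset.mem_filter, Finset.mem_powersetCard] at hT
      have hTg : T ⊆ gr M := hT.1.1.trans hB
      obtain ⟨hcl, hTcl⟩ := clF_mem_lines hTg hT.2
      have hmem : clF M T ∈ linesOf M B := by
        unfold linesOf
        rw [Finset.mem_filter]
        refine ⟨hcl, ?_⟩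
        calc 2 ≤ T.card := by rw [hT.1.2]; norm_num
          _ ≤ (clF M T ∩ B).card := Finset.card_le_card (Finset.subset_inter hTcl hT.1.1)
      have hsub : T ⊆ clF M T ∩ B := Finset.subset_inter hTcl hT.1.1
      have hcard : (clF M T ∩ B).card = 3 := by
        have h3 := hno4 _ hmem
        have := Finset.card_le_card hsub
        rw [hT.1.2] at this
        omega
      refine ⟨clF M T, ?_, ?_⟩
      · rw [hL₃, Finset.mem_filter]
        exact ⟨hmem, hcard⟩
      · exact (Finset.eq_of_subset_of_card_le hsub (by rw [hcard, hT.1.2])).symm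
  rw [hLam, Cells.Lam, ← hbij]
  have hc : (B.card.choose 2 : ℚ) = ((linesOf M B).card : ℚ) + 2 * (L₃.card : ℚ) := by
    exact_mod_cast hchoose
  rw [hc]
  ring

omit [DecidableEq α] in
/-- Membership in `R₃(G)`. -/
theorem mem_R3_iff {G B : Finset α} : B ∈ R3 M G ↔ B ⊆ G ∧ M.eRk (B : Set α) = 3 := by
  unfold R3
  rw [Finset.mem_filter, Finset.mem_powerset]

/-- **The per-plane inequality at `t = 1` from its cell.**  For a plane `G` of a rank-`7` simple matroid with
`ρ(E ∖ G) + 1 = 7`, no line meeting `G` in `≥ 4` points, the naive demand bound `hdem` (p3's `card_UqG_le_naive`)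
and the cell inequality `hcell` (the `(b, λ)`-profile of `G` against `v₁`), `28/5·#U_G ≤ Σ_{S ∈ Yq} f(G, S)/D(S)`. -/
theorem perPlane_t1_of_cell (hs : Simple M) (hrank : M.eRank = 7) {G : Finset α} (hG : G ∈ planes M)
    (ht : M.eRk ((gr M \ G : Finset α) : Set α) + (1 : ℕ∞) = 7)
    (hno4 : ∀ L ∈ lines M, (L ∩ G).card ≤ 3)
    (hdem : (UqG M 7 3 G).card ≤ ((R3 M G).filter (fun B => B.card + 1 ≤ G.card)).card)
    (hcell : (28 / 5 : ℚ) * (((R3 M G).filter (fun B => B.card + 1 ≤ G.card)).card : ℚ) ≤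
      ∑ B ∈ R3 M G, Cells.vOne B.card (lam3 M B)) :
    (28 / 5 : ℚ) * ((UqG M 7 3 G).card : ℚ) ≤ ∑ S ∈ Yq M 7 3, fRule M G S / D M S := by
  obtain ⟨K, hKsub, hKcard, hKr⟩ := exists_pool hG hrank (t := 1) (by exact_mod_cast ht)
  have hK : K ⊆ gr M := hKsub.trans Finset.sdiff_subset
  have hKG : Disjoint K G := Finset.disjoint_of_subset_left hKsub Finset.sdiff_disjoint
  have hK6 : K.card = 6 := by omega
  have hGg : G ⊆ gr M := (mem_planes.1 hG).1
  calc (28 / 5 : ℚ) * ((UqG M 7 3 G).card : ℚ)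
      ≤ (28 / 5 : ℚ) * (((R3 M G).filter (fun B => B.card + 1 ≤ G.card)).card : ℚ) := by
        gcongr
    _ ≤ ∑ B ∈ R3 M G, Cells.vOne B.card (lam3 M B) := hcell
    _ = ∑ B ∈ R3 M G, Cells.vOneL B.card (Lam M B) := by
        apply Finset.sum_congr rfl
        intro B hB
        obtain ⟨hBG, -⟩ := mem_R3_iff.1 hB
        rw [Cells.vOne, Lam_eq_of_no_four hs (hBG.trans hGg) (fun L hL => ?_)]
        have hL' : L ∈ lines M := (Finset.mem_filter.1 hL).1
        calc (L ∩ B).card ≤ (L ∩ G).card := Finset.card_le_card (Finset.inter_subset_inter_left hBG)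
          _ ≤ 3 := hno4 L hL'
    _ ≤ ∑ B ∈ R3 M G, ∑ X ∈ W K, fRule M G (B ∪ X) / D M (B ∪ X) := by
        apply Finset.sum_le_sum
        intro B hB
        obtain ⟨hBG, hrB⟩ := mem_R3_iff.1 hB
        exact witness_sum_six hs hG hBG hrB hK hKG hKr hK6
    _ ≤ ∑ S ∈ Yq M 7 3, fRule M G S / D M S := sum_R3_W_le_sum_Yq hG hKsub

/-- **The per-plane inequality at `t = 2` from its cell** (`|K| = 5`, `v₂`). -/
theorem perPlane_t2_of_cell (hs : Simple M) (hrank : M.eRank = 7) {G : Finset α} (hG : G ∈ planes M)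
    (ht : M.eRk ((gr M \ G : Finset α) : Set α) + (2 : ℕ∞) = 7)
    (hno4 : ∀ L ∈ lines M, (L ∩ G).card ≤ 3)
    (hdem : (UqG M 7 3 G).card ≤ ((R3 M G).filter (fun B => B.card + 2 ≤ G.card)).card)
    (hcell : (28 / 5 : ℚ) * (((R3 M G).filter (fun B => B.card + 2 ≤ G.card)).card : ℚ) ≤
      ∑ B ∈ R3 M G, Cells.vTwo B.card (lam3 M B)) :
    (28 / 5 : ℚ) * ((UqG M 7 3 G).card : ℚ) ≤ ∑ S ∈ Yq M 7 3, fRule M G S / D M S := by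
  obtain ⟨K, hKsub, hKcard, hKr⟩ := exists_pool hG hrank (t := 2) (by exact_mod_cast ht)
  have hK : K ⊆ gr M := hKsub.trans Finset.sdiff_subset
  have hKG : Disjoint K G := Finset.disjoint_of_subset_left hKsub Finset.sdiff_disjoint
  have hK5 : K.card = 5 := by omega
  have hGg : G ⊆ gr M := (mem_planes.1 hG).1
  calc (28 / 5 : ℚ) * ((UqG M 7 3 G).card : ℚ)
      ≤ (28 / 5 : ℚ) * (((R3 M G).filter (fun B => B.card + 2 ≤ G.card)).card : ℚ) := by
        gcongr
    _ ≤ ∑ B ∈ R3 M G, Cells.vTwo B.card (lam3 M B) := hcell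
    _ = ∑ B ∈ R3 M G, Cells.vTwoL B.card (Lam M B) := by
        apply Finset.sum_congr rfl
        intro B hB
        obtain ⟨hBG, -⟩ := mem_R3_iff.1 hB
        rw [Cells.vTwo, Lam_eq_of_no_four hs (hBG.trans hGg) (fun L hL => ?_)]
        have hL' : L ∈ lines M := (Finset.mem_filter.1 hL).1
        calc (L ∩ B).card ≤ (L ∩ G).card := Finset.card_le_card (Finset.inter_subset_inter_left hBG)
          _ ≤ 3 := hno4 L hL'
    _ ≤ ∑ B ∈ R3 M G, ∑ X ∈ W K, fRule M G (B ∪ X) / D M (B ∪ X) := by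
        apply Finset.sum_le_sum
        intro B hB
        obtain ⟨hBG, hrB⟩ := mem_R3_iff.1 hB
        exact witness_sum_five hs hG hBG hrB hK hKG hKr hK5
    _ ≤ ∑ S ∈ Yq M 7 3, fRule M G S / D M S := sum_R3_W_le_sum_Yq hG hKsub

/-- **The per-plane inequality at `t = 3` from its cell** (`|K| = 4`, `v₃`). -/
theorem perPlane_t3_of_cell (hs : Simple M) (hrank : M.eRank = 7) {G : Finset α} (hG : G ∈ planes M)
    (ht : M.eRk ((gr M \ G : Finset α) : Set α) + (3 : ℕ∞) = 7)
    (hno4 : ∀ L ∈ lines M, (L ∩ G).card ≤ 3)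
    (hdem : (UqG M 7 3 G).card ≤ ((R3 M G).filter (fun B => B.card + 3 ≤ G.card)).card)
    (hcell : (28 / 5 : ℚ) * (((R3 M G).filter (fun B => B.card + 3 ≤ G.card)).card : ℚ) ≤
      ∑ B ∈ R3 M G, Cells.vThree B.card (lam3 M B)) :
    (28 / 5 : ℚ) * ((UqG M 7 3 G).card : ℚ) ≤ ∑ S ∈ Yq M 7 3, fRule M G S / D M S := by
  obtain ⟨K, hKsub, hKcard, hKr⟩ := exists_pool hG hrank (t := 3) (by exact_mod_cast ht)
  have hK : K ⊆ gr M := hKsub.trans Finset.sdiff_subset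
  have hKG : Disjoint K G := Finset.disjoint_of_subset_left hKsub Finset.sdiff_disjoint
  have hK4 : K.card = 4 := by omega
  have hGg : G ⊆ gr M := (mem_planes.1 hG).1
  calc (28 / 5 : ℚ) * ((UqG M 7 3 G).card : ℚ)
      ≤ (28 / 5 : ℚ) * (((R3 M G).filter (fun B => B.card + 3 ≤ G.card)).card : ℚ) := by
        gcongr
    _ ≤ ∑ B ∈ R3 M G, Cells.vThree B.card (lam3 M B) := hcell
    _ = ∑ B ∈ R3 M G, Cells.vThreeL B.card (Lam M B) := by
        apply Finset.sum_congr rfl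
        intro B hB
        obtain ⟨hBG, -⟩ := mem_R3_iff.1 hB
        rw [Cells.vThree, Lam_eq_of_no_four hs (hBG.trans hGg) (fun L hL => ?_)]
        have hL' : L ∈ lines M := (Finset.mem_filter.1 hL).1
        calc (L ∩ B).card ≤ (L ∩ G).card := Finset.card_le_card (Finset.inter_subset_inter_left hBG)
          _ ≤ 3 := hno4 L hL'
    _ ≤ ∑ B ∈ R3 M G, ∑ X ∈ W K, fRule M G (B ∪ X) / D M (B ∪ X) := by
        apply Finset.sum_le_sum
        intro B hB
        obtain ⟨hBG, hrB⟩ := mem_R3_iff.1 hB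
        exact witness_sum_four hs hG hBG hrB hK hKG hKr hK4
    _ ≤ ∑ S ∈ Yq M 7 3, fRule M G S / D M S := sum_R3_W_le_sum_Yq hG hKsub

omit [M.Finite] in
/-- The `b`-subsets of `G` through `ℓ ⊆ G` number `C(|G| − |ℓ|, b − |ℓ|)` (`B ↦ B ∖ ℓ`). -/
theorem card_filter_subset_powersetCard {G ℓ : Finset α} (hℓG : ℓ ⊆ G) {b : ℕ} (hb : ℓ.card ≤ b) :
    ((G.powersetCard b).filter (fun B => ℓ ⊆ B)).card = (G \ ℓ).card.choose (b - ℓ.card) := by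
  rw [← Finset.card_powersetCard]
  apply Finset.card_bij (fun B _ => B \ ℓ)
  · intro B hB
    rw [Finset.mem_filter, Finset.mem_powersetCard] at hB
    rw [Finset.mem_powersetCard]
    refine ⟨Finset.sdiff_subset_sdiff hB.1.1 (Finset.Subset.refl ℓ), ?_⟩
    rw [Finset.card_sdiff, Finset.inter_eq_left.2 hB.2, hB.1.2]
  · intro B hB B' hB' h
    rw [Finset.mem_filter] at hB hB'
    rw [← Finset.sdiff_union_of_subset hB.2, ← Finset.sdiff_union_of_subset hB'.2, h]
  · intro C hC
    rw [Finset.mem_powersetCard] at hC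
    refine ⟨C ∪ ℓ, ?_, ?_⟩
    · rw [Finset.mem_filter, Finset.mem_powersetCard]
      refine ⟨⟨Finset.union_subset (hC.1.trans Finset.sdiff_subset) hℓG, ?_⟩, Finset.subset_union_right⟩
      rw [Finset.card_union_of_disjoint (Finset.disjoint_of_subset_left hC.1 Finset.sdiff_disjoint), hC.2]
      omega
    · rw [Finset.union_sdiff_right, Finset.sdiff_eq_self_of_disjoint (Finset.disjoint_of_subset_left hC.1 Finset.sdiff_disjoint)]


omit [M.Finite] in
/-- The `b`-subsets of `G` through `S ⊆ G`, for every `b`: `C(|G| − |S|, b − |S|)` when `|S| ≤ b`, else none. -/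
theorem card_filter_subset_powersetCard' {G S : Finset α} (hS : S ⊆ G) (b : ℕ) :
    ((G.powersetCard b).filter (fun B => S ⊆ B)).card =
      if S.card ≤ b then (G \ S).card.choose (b - S.card) else 0 := by
  by_cases hb : S.card ≤ b
  · rw [if_pos hb]; exact card_filter_subset_powersetCard hS hb
  · rw [if_neg hb, Finset.card_eq_zero, Finset.filter_eq_empty_iff]
    intro B hB hSB
    rw [Finset.mem_powersetCard] at hB
    exact hb (hB.2 ▸ Finset.card_le_card hSB)

end SevenThree

end PercRepro
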